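/-
Copyright: the b2b-balaban T⁴-continuum CRUX team, row NE7b leaf lineage `t4-ne7b-formalise-leaf-03` (gen 146). Project licence.
-/
import Mathlib.Analysis.Calculus.Implicit

/-!
# THE TWO EXISTENCE LETTERS OF THE NONLINEAR SECOND-ORDER ENVELOPE THEOREM, DISCHARGED: the SECTION of the constraint through the
# minimiser with prescribed derivative (Mathlib's implicit function theorem, transverse foliation `x ↦ x − δ₀ − N(T(x − δ₀))`), and the
# COERCIVITY of the Lagrangian form `𝓛 = q − s ≥ μ‖·‖²` from the constraint-adapted strong letter (so `…ConstrainedSchurForm` §4 produces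
# the fibre-minimiser map) — the letters `hσ`∕`hσ1` and (via CSTF) `hNmin` of `…ConstrainedValueLagrangian` from `HasStrictFDerivAt G T δ₀`
# and a continuous right inverse alone (row NE7b, node U5c; residual (R2′) family (2), letter (ℓ1); Mathlib only)

Cell `pub-balaban`, sub-cell `t4`, spine estimate NE7b (`T4WeightBudget.RelWeightBound`; the cell's OWN estimate — NOT PRINTED in
[Bałaban 1983–89], NOT PROVED).  Crux-route work under `Spine/NE7b/` by a row leaf on the convexity road; NOTHING of Bałaban's is named
or asserted; no `T4Continuum/Support` leaf typed (FREEZE (0)); no `def` (the `ImplicitFunctionData` is built INSIDE the proof); zero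
`sorry`.  Imports: `Mathlib.Analysis.Calculus.Implicit` only — independent of the farm's `Spine/NE7b` olean frontier and of
`…ConstrainedValueLagrangian` (CVL, p378628), whose END consumes §1 by `obtain ⟨σ, hσ, hσ1⟩ := …` (two binders, verbatim).

WHY.  CVL (this lineage) types T-85 (L2): the value function of a NONLINEAR constraint has second-order term = the constrained Schur form
of the LAGRANGIAN form, with print's letters displayed; its header lists as NOT HERE «the EXISTENCE of the section `σ` (implicit
function theorem — Mathlib `HasStrictFDerivAt.implicitFunction`; print's contraction (50)–(55)) and of the fibre-minimiser map `N` of `𝓛`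
(CSTF §4 `exists_constrMin` for `𝓛` positive definite)», and its chair (leaf-04 g151, ι-2) located that «the same scaling forces `𝓛 ≥ μ‖·‖²` … —
exactly the coercivity CSTF §4 needs to PRODUCE `N`».  THIS FILE discharges both: (§1) for `G` STRICTLY differentiable at `δ₀` with
derivative `T` and ANY continuous linear right inverse `N` of `T` (Banach `E`, `F`), a section `σ` with `G (σ h) = G δ₀ + h` near `0`,
`σ 0 = δ₀` and STRICT derivative `N` at `0` — Mathlib's general `ImplicitFunctionData` with left function `G` and the transverse
foliation `x ↦ x − δ₀ − N (T (x − δ₀))` valued in `ker T` (its kernel is `range N`, complementary to `ker T`), `σ h := implicitFunction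
(G δ₀ + h) 0`, whose derivative `e⁻¹ ∘ inl` is identified with `N` because `e (N y) = (T (N y), N y − N (T (N y))) = (y, 0)`; print's
chart `A = A′ − HD(A′)` (47) is this `σ` for `N = H`; (§2) a 2-homogeneous function bounded below by `−o(‖v‖²)` is `≥ 0`, whence the
constraint-adapted strong letter + the two Peano expansions + the Lagrange condition force `μ‖v‖² ≤ q v − s v` for EVERY `v`.

WHAT IS PROVED ([folklore]; the implicit function theorem — Mathlib `ImplicitFunctionData` (general version); scaling):
* §1 **`exists_section_hasStrictFDerivAt`** (`T (N w) = w`, `HasStrictFDerivAt G T δ₀`, `E`, `F` complete ⊢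
  `∃ σ, (∀ᶠ h in 𝓝 0, G (σ h) = G δ₀ + h) ∧ σ 0 = δ₀ ∧ HasStrictFDerivAt σ N 0`) and **`exists_section_isLittleO`** (the same in CVL's
  binder shape: `G δ₀ = w₀ ⊢ ∃ σ, (∀ᶠ h in 𝓝 0, G (σ h) = w₀ + h) ∧ (h ↦ σ h − δ₀ − N h) =o[𝓝 0] h`).
* §2 `nonneg_of_two_homogeneous_of_eventually` (`p (t • v) = t² p v`, `∀ ε > 0`, eventually `−ε‖v‖² ≤ p v` ⊢ `0 ≤ p`) and
  **`le_lagrangianForm_of_firstOrderG`** (`V δ₀ + Λ (G δ − G δ₀) + μ‖δ − δ₀‖² ≤ V δ` for all `δ`, `V′ = Λ ∘ T`, the expansions of `V`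
  (form `q`) and of `Λ ∘ (G (δ₀ + ·) − G δ₀ − T)` (form `s`) with `q`, `s` 2-homogeneous ⊢ `μ‖v‖² ≤ q v − s v` for every `v`).

NOT HERE (honest): the fibre-minimiser map itself (CSTF §4 `exists_constrMin`, finite dimension — §2 supplies its positivity hypothesis
for `μ > 0`; olean-gated); `C²`-regularity of the section beyond the strict derivative at `0`; which `G`, `T`, `N` of Bałaban's ((A3) ∕
(A1c), NC-NE7b-α UNRULED — print's `Q_k`, its linearisation and `H = GQ*(QGQ*)⁻¹` as SHAPES only); any value.  BY-NAME EFFECT ON THE WALL: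
NONE.  NE7b NOT PRINTED ∕ NOT PROVED; spine PROVED 0∕9; rung (B)+1 on a FINITE torus — NOT infinite volume, NOT the mass gap, NOT Clay.
HONEST DEPENDENCY: continuum YM on T⁴ ⇐ BetaPertH ∧ nine spine estimates (0/9 proved); BetaPertH ⇐ (D1) ∧ (D4) ∧ CAP+tail; G-an2-4
gates asym, D1 and NE2∕3∕4.
-/

set_option autoImplicit false

open Set Function Filter Asymptotics Metric
open scoped Topology

namespace Summit.QuantumFields.BalabanUV.T4Continuum.NE7b.ConstrainedValueSection

/-! ## §1 The section through the minimiser with prescribed derivative (implicit function theorem) -/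

section IFT

variable {E F : Type*} [NormedAddCommGroup E] [NormedSpace ℝ E] [CompleteSpace E]
  [NormedAddCommGroup F] [NormedSpace ℝ F] [CompleteSpace F]

/-- **THE SECTION WITH PRESCRIBED DERIVATIVE (implicit function theorem).**  `G` strictly differentiable at `δ₀` with derivative
`T`, `N` a continuous linear right inverse of `T` (`T (N w) = w`), `E`, `F` complete ⟹ there is `σ : F → E` with `G (σ h) = G δ₀ + h`
for all small `h`, `σ 0 = δ₀`, and STRICT derivative `N` at `0`.  Construction: Mathlib's `ImplicitFunctionData` with left function `G`
and right function `x ↦ x − δ₀ − N (T (x − δ₀))` valued in `ker T` (a projection onto `ker T` with kernel `range N`);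
`σ h := implicitFunction (G δ₀ + h) 0`; the derivative `e.symm ∘ inl` equals `N` since `e (N y) = (y, 0)`.  Print's linearising chart
`A = A′ − HD(A′)` (CMP 102 (47)) is this section for `N = H`. [folklore] -/
theorem exists_section_hasStrictFDerivAt {G : E → F} {T : E →L[ℝ] F} {N : F →L[ℝ] E} (hN : ∀ w, T (N w) = w) {δ₀ : E}
    (hT : HasStrictFDerivAt G T δ₀) :
    ∃ σ : F → E, (∀ᶠ h in 𝓝 (0 : F), G (σ h) = G δ₀ + h) ∧ σ 0 = δ₀ ∧ HasStrictFDerivAt σ N 0 := by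
  -- the projection onto `ker T` along `range N`
  have hPmem : ∀ x : E, (ContinuousLinearMap.id ℝ E - N.comp T) x ∈ T.ker := by
    intro x
    simp [LinearMap.mem_ker, hN]
  set P : E →L[ℝ] T.ker := (ContinuousLinearMap.id ℝ E - N.comp T).codRestrict T.ker hPmem with hP
  have hPproj : ∀ x : T.ker, P x = x := by
    intro x
    ext
    have hx : T x = 0 := x.2
    simp [hP, hx]
  have hrange : T.range = ⊤ := LinearMap.range_eq_top.2 fun y => ⟨N y, hN y⟩
  let φ : ImplicitFunctionData ℝ E F T.ker :=
    { leftFun := G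
      leftDeriv := T
      rightFun := fun x => P (x - δ₀)
      rightDeriv := P
      pt := δ₀
      hasStrictFDerivAt_leftFun := hT
      hasStrictFDerivAt_rightFun := P.hasStrictFDerivAt.comp δ₀ ((hasStrictFDerivAt_id δ₀).sub_const δ₀)
      range_leftDeriv := hrange
      range_rightDeriv := LinearMap.range_eq_of_proj hPproj
      isCompl_ker := LinearMap.isCompl_of_proj hPproj }
  have hpt : φ.prodFun φ.pt = (G δ₀, 0) := by simp [ImplicitFunctionData.prodFun_apply, φ]
  refine ⟨fun h => φ.implicitFunction (G δ₀ + h) 0, ?_, ?_, ?_⟩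
  · -- `G (σ h) = G δ₀ + h` near `0`
    have hev := φ.leftFun_implicitFunction
    rw [hpt] at hev
    have hc : Continuous fun h : F => (G δ₀ + h, (0 : T.ker)) := (continuous_const.add continuous_id).prodMk continuous_const
    have ht : Tendsto (fun h : F => (G δ₀ + h, (0 : T.ker))) (𝓝 0) (𝓝 (G δ₀, 0)) := by simpa using hc.tendsto 0
    exact (ht.eventually hev).mono fun h hh => hh
  · -- `σ 0 = δ₀`
    have h1 := φ.implicitFunction_apply_image.self_of_nhds
    simpa [φ] using h1
  · -- strict derivative `N` at `0`
    set e := (T.equivProdOfSurjectiveOfIsCompl P hrange (LinearMap.range_eq_of_proj hPproj)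
      (LinearMap.isCompl_of_proj hPproj)) with he
    have hinv : HasStrictFDerivAt φ.toOpenPartialHomeomorph.symm ((e.symm : (F × T.ker) ≃L[ℝ] E) : (F × T.ker) →L[ℝ] E)
        (G δ₀, (0 : T.ker)) := by
      have h1 := φ.hasStrictFDerivAt.to_localInverse
      rw [hpt] at h1
      exact h1
    have hlin : HasStrictFDerivAt (fun h : F => (G δ₀ + h, (0 : T.ker))) (ContinuousLinearMap.inl ℝ F T.ker) 0 := by
      have hid : HasStrictFDerivAt (fun h : F => G δ₀ + h) (ContinuousLinearMap.id ℝ F) 0 :=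
        (hasStrictFDerivAt_id (𝕜 := ℝ) (0 : F)).const_add (G δ₀)
      have hc0 : HasStrictFDerivAt (fun _ : F => (0 : T.ker)) (0 : F →L[ℝ] T.ker) 0 := hasStrictFDerivAt_const (0 : T.ker) (0 : F)
      have := hid.prodMk hc0
      convert this using 1
      ext <;> simp
    have hcomp := (show HasStrictFDerivAt φ.toOpenPartialHomeomorph.symm _ (G δ₀ + 0, (0 : T.ker)) by simpa using hinv).comp
      (0 : F) hlin
    -- identify the derivative: `e.symm (y, 0) = N y`
    have hNe : ∀ y : F, ((e.symm : (F × T.ker) ≃L[ℝ] E) : (F × T.ker) →L[ℝ] E) (y, 0) = N y := by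
      intro y
      have h1 : e (N y) = (y, 0) := by
        have h2 : P (N y) = 0 := by
          ext; simp [hP, hN]
        simp [he, hN y, h2]
      rw [← h1]
      exact e.symm_apply_apply (N y)
    have hderiv : ((e.symm : (F × T.ker) ≃L[ℝ] E) : (F × T.ker) →L[ℝ] E).comp (ContinuousLinearMap.inl ℝ F T.ker) = N := by
      ext y; simp [hNe]
    rw [hderiv] at hcomp
    exact hcomp

/-- **THE SECTION LETTER OF `…ConstrainedValueLagrangian` DISCHARGED** (its binders `hσ`, `hσ1` verbatim): `T (N w) = w`,
`G δ₀ = w₀`, `HasStrictFDerivAt G T δ₀` ⟹ `∃ σ, (∀ᶠ h in 𝓝 0, G (σ h) = w₀ + h) ∧ (h ↦ σ h − δ₀ − N h) =o[𝓝 0] h`. [folklore] -/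
theorem exists_section_isLittleO {G : E → F} {T : E →L[ℝ] F} {N : F →L[ℝ] E} (hN : ∀ w, T (N w) = w) {δ₀ : E} {w₀ : F}
    (hG0 : G δ₀ = w₀) (hT : HasStrictFDerivAt G T δ₀) :
    ∃ σ : F → E, (∀ᶠ h in 𝓝 (0 : F), G (σ h) = w₀ + h) ∧ (fun h => σ h - δ₀ - N h) =o[𝓝 (0 : F)] fun h => h := by
  obtain ⟨σ, hσ, hσ0, hσd⟩ := exists_section_hasStrictFDerivAt hN hT
  refine ⟨σ, by simpa only [hG0] using hσ, ?_⟩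
  have h := hasFDerivAt_iff_isLittleO_nhds_zero.1 hσd.hasFDerivAt
  simpa only [zero_add, hσ0] using h

end IFT

/-! ## §2 The Lagrangian form is coercive (so `…ConstrainedSchurForm` §4 produces the fibre-minimiser map) -/

section Coercive

variable {E F : Type*} [NormedAddCommGroup E] [NormedSpace ℝ E] [NormedAddCommGroup F] [NormedSpace ℝ F]

/-- A 2-homogeneous function which is `≥ −o(‖v‖²)` at `0` is `≥ 0` (scale `v` into the neighbourhood). [folklore] -/
theorem nonneg_of_two_homogeneous_of_eventually {p : E → ℝ} (hp : ∀ (t : ℝ) (v : E), p (t • v) = t ^ 2 * p v)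
    (hev : ∀ ε : ℝ, 0 < ε → ∀ᶠ v in 𝓝 (0 : E), -(ε * ‖v‖ ^ 2) ≤ p v) (v : E) : 0 ≤ p v := by
  by_contra hneg
  rw [not_le] at hneg
  have hv : v ≠ 0 := by
    rintro rfl
    have h0 : p 0 = 0 := by simpa using hp 0 0
    exact hneg.ne h0
  have hnv : 0 < ‖v‖ := norm_pos_iff.2 hv
  have hε : 0 < -p v / (2 * ‖v‖ ^ 2) := by
    apply div_pos (by linarith) (by positivity)
  obtain ⟨r, hr, hball⟩ := Metric.eventually_nhds_iff.1 (hev _ hε)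
  set t : ℝ := r / (2 * ‖v‖) with ht
  have htpos : 0 < t := by positivity
  have hnorm : ‖t • v‖ = t * ‖v‖ := by rw [norm_smul, Real.norm_of_nonneg htpos.le]
  have hth : t * ‖v‖ = r / 2 := by rw [ht]; field_simp
  have hk := hball (show dist (t • v) 0 < r by rw [dist_zero_right, hnorm, hth]; linarith)
  rw [hp, hnorm, mul_pow] at hk
  have h1 : -p v / (2 * ‖v‖ ^ 2) * (t ^ 2 * ‖v‖ ^ 2) = t ^ 2 * (-p v / 2) := by field_simp
  rw [h1] at hk
  have h2 : 0 < t ^ 2 := by positivity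
  nlinarith [mul_lt_mul_of_pos_left (show p v < -p v / 2 by linarith) h2]

/-- **THE LAGRANGIAN FORM IS COERCIVE** from the constraint-adapted strong letter: `V δ₀ + Λ (G δ − G δ₀) + μ‖δ − δ₀‖² ≤ V δ`,
the two second-order expansions at `δ₀` with 2-homogeneous forms `q`, `s`, and `V′ = Λ ∘ T` ⟹ `μ‖v‖² ≤ q v − s v` for every `v`
(so for `μ > 0` the Lagrangian form is positive definite and CSTF §4 produces the fibre-minimiser map `N`). [folklore] -/
theorem le_lagrangianForm_of_firstOrderG {V q s : E → ℝ} {G : E → F} {V' : E →L[ℝ] ℝ} {Λ : F →L[ℝ] ℝ} {T : E →L[ℝ] F} {δ₀ : E}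
    {μ : ℝ} (hfoG : ∀ δ, V δ₀ + Λ (G δ - G δ₀) + μ * ‖δ - δ₀‖ ^ 2 ≤ V δ) (hlag : ∀ v, V' v = Λ (T v))
    (hV2 : (fun v => V (δ₀ + v) - V δ₀ - V' v - q v) =o[𝓝 (0 : E)] fun v => ‖v‖ ^ 2)
    (hG2 : (fun v => Λ (G (δ₀ + v) - G δ₀ - T v) - s v) =o[𝓝 (0 : E)] fun v => ‖v‖ ^ 2)
    (hq : ∀ (t : ℝ) (v : E), q (t • v) = t ^ 2 * q v) (hs : ∀ (t : ℝ) (v : E), s (t • v) = t ^ 2 * s v) (v : E) :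
    μ * ‖v‖ ^ 2 ≤ q v - s v := by
  have key := nonneg_of_two_homogeneous_of_eventually (p := fun v => q v - s v - μ * ‖v‖ ^ 2)
    (fun t v => by simp only [hq, hs, norm_smul, mul_pow, Real.norm_eq_abs, sq_abs]; ring) ?_ v
  · linarith
  intro ε hε
  have hε2 : 0 < ε / 2 := by positivity
  filter_upwards [hV2.def hε2, hG2.def hε2] with w hVw hGw
  rw [Real.norm_eq_abs, Real.norm_of_nonneg (by positivity), abs_le] at hVw hGw
  have h1 := hfoG (δ₀ + w)
  rw [add_sub_cancel_left] at h1
  have h2 : Λ (G (δ₀ + w) - G δ₀) = Λ (T w) + Λ (G (δ₀ + w) - G δ₀ - T w) := by rw [map_sub Λ (G (δ₀ + w) - G δ₀) (T w)]; ring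
  rw [h2] at h1
  have h3 := hlag w
  linarith [hVw.1, hVw.2, hGw.1, hGw.2]

end Coercive

end Summit.QuantumFields.BalabanUV.T4Continuum.NE7b.ConstrainedValueSection
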